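import Summits.QuantumFields.BalabanUV.Beta.GAN24.CombNaturalWindowH1
import Summits.QuantumFields.BalabanUV.Beta.GAN24.NaturalWindowShort

/-!
# `BalabanUV.Beta.GAN24.CombNaturalWindowShort` — binder row G-an2-4 ∕ (CONV-C), TRANSFER-III (the (III′) column of RULING R-gan24p1-g46-2), THE COMB LEG DICTIONARY, NINTH WORD =
# THE PART-6b TWIN: **THE SHORT WINDOWS OF THE COMB-CHART LEG CHAIN, FROM THE SOURCES' RATE `δ_S` TO THE TOWER's RATE `δ` — ANY START, EVERY LENGTH `< k₀`, ONE PAIR OF CONSTANTS**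
# (OWNER `b2b-balaban-gan24-p1`, gen 47; MY part 6b `NaturalWindowShort` re-run BY NAME on the sixth and seventh words; no existing file touched)

NOT IN PRINT; OUR BOOKKEEPING ([folklore] assembly BY NAME + the rate arithmetic, the (E) proofs token for token with `coDressKBmAt (toSite rr) Lc (KInvStep Lc j) ↦ GcombSh Lc j`, the root
quantifier dropped (centred by construction), the potential `Ψ − bmGaugeAt ↦ Ψ + PsiFace − bmGaugeAt`; 0 `def`, 0 cited facts, 0 `def … : Prop`, 0 sorry).  HONEST FRAMING (cell
contract, verbatim): «discharging `BetaPertH` makes Bałaban's UV stability UNCONDITIONAL — a real constructive-QFT result; it is NOT the continuum limit and NOT the Clay problem.»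
HONEST DEPENDENCY (verbatim): «continuum YM on T⁴ ⇐ BetaPertH ∧ nine spine estimates (0/9 proved); BetaPertH ⇐ (D1) ∧ (D4) ∧ CAP+tail; G-an2-4 gates asym, D1 and NE2/3/4.»

WHAT (`d = 3`, `2 ≤ Lc`, pin `|c| ≤ Lc^{2(d+1)}`, `G′♮_j := unitK (sfStep Lc j) (smStep 3 Lc j) (GcombSh Lc j)`): `comb_window_two_rates` (one window of length `q+1` at two rates, the
(E) `window_two_rates`) and **`short_windows_of_combChart`** — ONE `κ₁ > 0` with, for all rates `0 < δ ≤ δ_S` with `18(d+1)·δ ≤ κ₁` and `108(d+1)·δ ≤ δ_S·Lc`, for every `k₀`,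
constants `A ≥ 1`, `B ≥ 0` such that EVERY window of the comb-chart leg chain of length `q < k₀` (any start `p`) maps a bounded `LocStencil₂ W C δ_S` table with the five slot
rows at rate `δ_S` to `LocStencil₂ (legChain kc G′♮ Lc p q (bsumPow Lc q ∘ W)) (A·C + B·g) δ` — the (H1w)_{δS→δ} ∕ (HwD)_{δS→δD} ∕ (H1Δw)_{δ→δD} binders of gan24-formalise-leaf-03 g81's
W3 display (instantiated at the pairs of rates the END picks), MY part 6b `NaturalWindowShort.short_windows_of_dressed_comb` VERBATIM for the comb-chart kernels.  NOT (Q-L) ∕ (C)sym;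
NEVER «G-an2-4 closed» as (CONV-C); NOT D1, NOT `BetaPertH`, NOT continuum, NOT Clay.  2026-08-25.
-/

noncomputable section

open Finset
open scoped BigOperators
open Literature.MathematicalPhysics.QuantumFieldTheory
open Literature.MathematicalPhysics.QuantumFieldTheory.LatticeForm (quo)
open Literature.MathematicalPhysics.QuantumFieldTheory.Balaban1983to89
open Literature.MathematicalPhysics.QuantumFieldTheory.Balaban1983to89.Beta
open B4ContourShift (supNorm supNorm_nonneg)
open B6BondElimination (unitVec)
open B12Sec2to5 (l1 l1_nonneg)
open ExpKernelCalculus (MKer Decays Zl Zl_nonneg Zl_pos)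
open OneStepResolventKernel (Fib)
open OneStepKernelFamily (KInvStep colH)
open AffineAveraging (Site box toSite)
open BalabanCompositeJets (LocStencil₂ LocStencil₂.nonneg LocStencil₂.mono respStep)
open Summit.QuantumFields.BalabanUV.Beta.HessKerDressedUnits (unitK)
open Summit.QuantumFields.BalabanUV.Beta.AxialDressingRooted (coDressKBmAt)
open Summit.QuantumFields.BalabanUV.Beta.AxialProjectorBlockMean (bmGaugeAt)
open Summit.QuantumFields.BalabanUV.Beta.GAN24.CombesThomas (sfStep smStep)
open Summit.QuantumFields.BalabanUV.Beta.GAN24.BiStencilZeroMode (Tab)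
open Summit.QuantumFields.BalabanUV.Beta.GAN24.Lin4LegTowerUnroll (bsumPow)
open Summit.QuantumFields.BalabanUV.Beta.GAN24.TransportMarginal (locStencil₂_weaken)
open Summit.QuantumFields.BalabanUV.Beta.GAN24.RespStepBmDecompLegs (legAct)
open Summit.QuantumFields.BalabanUV.Beta.GAN24.RespStepBmDecompPsi (Psi)
open Summit.QuantumFields.BalabanUV.Beta.GAN24.LegStepPush (krow)
open Summit.QuantumFields.BalabanUV.Beta.GAN24.LegChainPush (kChain)
open Summit.QuantumFields.BalabanUV.Beta.GAN24.LegChainPushDressed (abs_prod_kcPin_le)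
open Summit.QuantumFields.BalabanUV.Beta.GAN24.LegPushDressedBoundBlockL1 (locStencil₂_legChain_bsumPow_of_dressed_envelopes_of_blockL1)
open Summit.QuantumFields.BalabanUV.Beta.GAN24.CombCarrierKernelLegBlockL1 (decays_combStep exists_kChain_comb_blockMass)
open Summit.QuantumFields.BalabanUV.Beta.GAN24.CombSlotLegSplit (legChain_comb_colH_eq exists_comb_slotLeg_envelopes)
open Summit.QuantumFields.BalabanUV.Beta.GAN24.CombLegChainGauge (PsiFace)
open Summit.QuantumFields.BalabanUV.Beta.CombChartStepJets (GcombSh)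
open AveragingContoursRooted (ctrOff ctrOff_mem_box)
open Summit.QuantumFields.BalabanUV.Beta.GAN24.TaylorBlockSum (nonneg_of_dominated)
open Summit.QuantumFields.BalabanUV.Beta.GAN24.FineReadoutGradientDecay (exp_neg_mul_le_of_le)

namespace Summit.QuantumFields.BalabanUV.Beta.GAN24.CombNaturalWindowShort

variable {Lc : ℕ} [NeZero Lc]

/-- NOT IN PRINT; OUR BOOKKEEPING.  **THE DRESSED COMB WINDOW AT TWO RATES, EVERY LENGTH WITH THE GAP** (as displayed in the module docstring): rate-in `δ_S` (table class
and slot rows), rate-out `δ` (`κ₀ := 18(d+1)·δ ≤ κ₁`), length `q+1` with `108(d+1)·δ ≤ δ_S·Lc^{q+1}`; constants `θ_q, Cg_q ≥ 0` uniform in the root, the start and the table. -/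
theorem comb_window_two_rates (hLc : 2 ≤ Lc) {c : ℝ} (hc : |c| ≤ (Lc : ℝ) ^ (2 * (3 + 1))) :
    ∃ κ₁ : ℝ, 0 < κ₁ ∧ ∀ δS δ : ℝ, 0 < δS → 0 < δ → 18 * (((3 : ℕ) : ℝ) + 1) * δ ≤ κ₁ → ∀ q : ℕ,
      ∃ θq Cgq : ℝ, 0 ≤ θq ∧ 0 ≤ Cgq ∧ (108 * (((3 : ℕ) : ℝ) + 1) * δ ≤ δS * (Lc : ℝ) ^ (q + 1) →
        ∀ (p : ℕ) (W : Tab 3) (C g : ℝ),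
          (∃ B : ℝ, ∀ κ u κ' u' x z a b, |W κ u κ' u' x z a b| ≤ B) → LocStencil₂ W C δS →
          (∀ (κ₁ : Fin (3 + 1)) (v : Site (3 + 1)) (κ₂ : Fin (3 + 1)) (x p : Site (3 + 1)) (f b : Fib 3),
              |∑' v', W κ₁ v κ₂ v' x p f b| ≤ g * Real.exp (-δS * (l1 (x - v) + l1 (p - v)))) →
          (∀ (κ₁ κ₂ : Fin (3 + 1)) (v' x p : Site (3 + 1)) (f b : Fib 3),
              |∑' v, W κ₁ v κ₂ v' x p f b| ≤ g * Real.exp (-δS * (l1 (x - v') + l1 (p - v')))) →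
          (∀ (κ₁ κ₂ : Fin (3 + 1)) (x p : Site (3 + 1)) (f b : Fib 3),
              |∑' v, ∑' v', W κ₁ v κ₂ v' x p f b| ≤ g * Real.exp (-δS * l1 (p - x))) →
          (∀ (κ : Fin (3 + 1)) (v w x p : Site (3 + 1)) (f b : Fib 3),
              |∑ μ, (W κ v μ (w - unitVec μ) x p f b - W κ v μ w x p f b)|
                ≤ g * Real.exp (-δS * l1 (w - v)) * Real.exp (-δS * (l1 (x - v) + l1 (p - v)))) →
          (∀ (κ' : Fin (3 + 1)) (w v' x p : Site (3 + 1)) (f b : Fib 3),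
              |∑ κ, (W κ (w - unitVec κ) κ' v' x p f b - W κ w κ' v' x p f b)|
                ≤ g * Real.exp (-δS * l1 (v' - w)) * Real.exp (-δS * (l1 (x - w) + l1 (p - w)))) →
          LocStencil₂
            (Lin4LegTowerUnroll.legChain (fun _ : ℕ => -((c * (Lc : ℝ) ^ (2 * (3 + 1))) * ((Lc : ℝ) ^ (3 + 1))⁻¹))
              (fun j => unitK (sfStep Lc j) (smStep 3 Lc j) (GcombSh (d := 3) Lc j)) Lc p (q + 1)
              (fun κ u κ' u' => bsumPow Lc (q + 1) (W κ u κ' u')))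
            (θq * C + Cgq * g) δ) := by
  classical
  have hLc1 : 1 ≤ Lc := le_trans (by norm_num) hLc
  have hLpos : (0 : ℝ) < (Lc : ℝ) := by exact_mod_cast (show 0 < Lc by omega)
  obtain ⟨κa, K'', hκa, hK'', hBM⟩ := exists_kChain_comb_blockMass (Lc := Lc) hLc
  obtain ⟨κb, Cr, Cr', Cφ, hκb, hCr, hCr', hCφ, hENV⟩ := exists_comb_slotLeg_envelopes (Lc := Lc) hLc
  refine ⟨min κa κb, lt_min hκa hκb, ?_⟩
  intro δS δ hδS hδ hδκ q
  set κ₀ : ℝ := 18 * (((3 : ℕ) : ℝ) + 1) * δ with hκ₀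
  have hκ₀0 : 0 < κ₀ := by positivity
  have hκ₀a : κ₀ ≤ κa := hδκ.trans (min_le_left _ _)
  have hκ₀b : κ₀ ≤ κb := hδκ.trans (min_le_right _ _)
  have hZ6 := Zl_nonneg (D := 3 + 1) (show 0 < δS / 6 by positivity)
  have hZ12 := Zl_nonneg (D := 3 + 1) (show 0 < δS / 6 / 2 by positivity)
  have hZ2 := Zl_nonneg (D := 3 + 1) (show 0 < δS / 2 by positivity)
  have hZκ := Zl_nonneg (D := 3 + 1) (show 0 < κ₀ / (2 * (((3 : ℕ) : ℝ) + 1)) by positivity)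
  set X : ℝ := 2 / (δS / 6) * Zl (3 + 1) (δS / 6 / 2) with hX
  have hX0 : 0 ≤ X := by rw [hX]; positivity
  set Lr : ℝ := (Lc : ℝ) ^ (q + 1) with hLr
  have hLr0 : 0 < Lr := by rw [hLr]; positivity
  have hLcast : (((Lc ^ (q + 1) : ℕ) : ℝ)) = Lr := by rw [hLr, Nat.cast_pow]
  set a : ℝ := Cr * ((Lc : ℝ) ^ (5 * (q + 1)))⁻¹ with ha
  set a' : ℝ := Cr' * ((Lc : ℝ) ^ (6 * (q + 1)))⁻¹ with ha'
  set aφ : ℝ := Cφ * ((Lc : ℝ) ^ (4 * (q + 1)))⁻¹ with haφ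
  set aρ : ℝ := K'' * ((q : ℝ) + 1) * ((Lc : ℝ) ^ (q + 1))⁻¹ * ((((Lc ^ (q + 1) : ℕ) : ℝ)) ^ (3 + 1))⁻¹ with haρ
  have ha0 : 0 ≤ a := by rw [ha]; positivity
  have ha'0 : 0 ≤ a' := by rw [ha']; positivity
  have haφ0 : 0 ≤ aφ := by rw [haφ]; positivity
  have haρ0 : 0 ≤ aρ := by rw [haρ]; positivity
  set P : ℝ := (((Lc ^ (q + 1) : ℕ) : ℝ)) ^ (3 * (3 + 1)) with hP
  have hP0 : 0 ≤ P := by rw [hP]; positivity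
  set θq : ℝ := P * ((Fintype.card (Fib 3) : ℝ) * (((3 : ℕ) : ℝ) + 1) ^ 2 *
      (aρ * ((Real.exp κ₀ * Zl (3 + 1) (δS / 6)) * (a' ^ 2 * Real.exp κ₀ ^ 2 * X ^ 2)) *
        ((((Lc ^ (q + 1) : ℕ) : ℝ)) ^ (3 + 1) * Zl (3 + 1) (κ₀ / (2 * (((3 : ℕ) : ℝ) + 1)))))) with hθq
  have hθq0 : 0 ≤ θq := by rw [hθq]; positivity
  set Cgq : ℝ := P * ((Fintype.card (Fib 3) : ℝ) * (((3 : ℕ) : ℝ) + 1) ^ 2 *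
      (aρ * ((Real.exp κ₀ * Zl (3 + 1) (δS / 6)) * (2 * (a * a' * Real.exp κ₀ * X) + a ^ 2)) *
        ((((Lc ^ (q + 1) : ℕ) : ℝ)) ^ (3 + 1) * Zl (3 + 1) (κ₀ / (2 * (((3 : ℕ) : ℝ) + 1)))))
      + (Fintype.card (Fib 3) : ℝ) * (aρ * ((((3 : ℕ) : ℝ) + 1) * (2 * (a * aφ) + aφ * aφ * (Real.exp δS ^ 3 + 1))) *
        (Real.exp κ₀ ^ 5 * Zl (3 + 1) (δS / 2) ^ 3 * ((((Lc ^ (q + 1) : ℕ) : ℝ)) ^ (3 + 1) * Zl (3 + 1) (κ₀ / (2 * (((3 : ℕ) : ℝ) + 1))))))) with hCgq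
  have hCgq0 : 0 ≤ Cgq := by rw [hCgq]; positivity
  refine ⟨θq, Cgq, hθq0, hCgq0, ?_⟩
  intro hgapq p W C g hB hW hq₂ hq₁ hq₁₂ hD₂ hD₁
  obtain ⟨B, hWb⟩ := hB
  have hg : 0 ≤ g := nonneg_of_dominated (Real.exp_pos _) (hq₁₂ 0 0 0 0 (Sum.inl 0) (Sum.inl 0))
  have hC0 : 0 ≤ C := hW.nonneg
  have hgap : κ₀ ≤ δS / 6 * ((Lc ^ (q + 1) : ℕ) : ℝ) := by
    rw [hLcast]
    have h6 : κ₀ = 108 * (((3 : ℕ) : ℝ) + 1) * δ / 6 := by rw [hκ₀]; ring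
    rw [h6, show δS / 6 * Lr = δS * Lr / 6 by ring]
    exact div_le_div_of_nonneg_right hgapq (by norm_num)
  obtain ⟨hr0, hr'0, hφ0⟩ := hENV p q
  have hE := legChain_comb_colH_eq (d := 3) (Lc := Lc) p q
  have hr : ∀ (μ : Fin (3 + 1)) (y : Site (3 + 1)) (κ : Fin (3 + 1)) (v : Site (3 + 1)),
      |respStep (d := 3) (Lc ^ p) (Lc ^ (p + q + 1)) μ y κ v|
        ≤ a * Real.exp (-(κ₀ * supNorm (quo (Lc ^ (q + 1)) v - y))) := fun μ y κ v =>
    (hr0 μ y κ v).trans (mul_le_mul_of_nonneg_left (exp_neg_mul_le_of_le hκ₀b (supNorm_nonneg _)) ha0)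
  have hr' : ∀ (μ : Fin (3 + 1)) (y : Site (3 + 1)) (κ : Fin (3 + 1)) (v : Site (3 + 1)) (i : Fin (3 + 1)),
      |respStep (d := 3) (Lc ^ p) (Lc ^ (p + q + 1)) μ y κ (v + Pi.single i 1) - respStep (d := 3) (Lc ^ p) (Lc ^ (p + q + 1)) μ y κ v|
        ≤ a' * Real.exp (-(κ₀ * supNorm (quo (Lc ^ (q + 1)) v - y))) := fun μ y κ v i =>
    (hr'0 μ y κ v i).trans (mul_le_mul_of_nonneg_left (exp_neg_mul_le_of_le hκ₀b (supNorm_nonneg _)) ha'0)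
  have hφ : ∀ (μ : Fin (3 + 1)) (y v : Site (3 + 1)),
      |(fun (μ : Fin (3 + 1)) (y v : Site (3 + 1)) =>
          Psi (toSite (ctrOff (3 + 1) Lc)) Lc p q (fun μ' y' => if μ' = μ then (if y' = y then (1 : ℝ) else 0) else 0) v
            + PsiFace (ctrOff (3 + 1) Lc) (toSite (ctrOff (3 + 1) Lc)) Lc p q (fun μ' y' => if μ' = μ then (if y' = y then (1 : ℝ) else 0) else 0) v
            - bmGaugeAt (toSite (ctrOff (3 + 1) Lc)) (legAct (respStep (d := 3) (Lc ^ p) (Lc ^ (p + q + 1)))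
                (fun μ' y' => if μ' = μ then (if y' = y then (1 : ℝ) else 0) else 0)) Lc v) μ y v|
        ≤ aφ * Real.exp (-(κ₀ * supNorm (quo (Lc ^ (q + 1)) v - y))) := fun μ y v =>
    (hφ0 μ y v).trans (mul_le_mul_of_nonneg_left (exp_neg_mul_le_of_le hκ₀b (supNorm_nonneg _)) haφ0)
  have hl₁ : ∀ (α : Fin (3 + 1)) (x' : Site (3 + 1)) (f : Fib 3) (c' : Site (3 + 1)),
      ∑ t ∈ box (3 + 1) (Lc ^ (q + 1)),
          |kChain (fun j => krow (unitK (sfStep Lc j) (smStep 3 Lc j) (GcombSh (d := 3) Lc j)) Lc) p q α x' f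
              (((Lc ^ (q + 1) : ℕ) : ℤ) • c' + toSite t)|
        ≤ aρ * (((Lc ^ (q + 1) : ℕ) : ℝ)) ^ (3 + 1) * Real.exp (-(κ₀ * supNorm (c' - x'))) := by
    intro α x' f c'
    refine (hBM p q α x' f c').trans ?_
    have e : aρ * (((Lc ^ (q + 1) : ℕ) : ℝ)) ^ (3 + 1) = K'' * ((q : ℝ) + 1) * ((Lc : ℝ) ^ (q + 1))⁻¹ := by
      rw [haρ]
      have hne : (((Lc ^ (q + 1) : ℕ) : ℝ)) ^ (3 + 1) ≠ 0 := by rw [hLcast]; positivity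
      field_simp
    rw [e]
    exact mul_le_mul_of_nonneg_left (exp_neg_mul_le_of_le hκ₀a (supNorm_nonneg _)) (by positivity)
  have R := locStencil₂_legChain_bsumPow_of_dressed_envelopes_of_blockL1 (d := 3)
    (K := fun j => unitK (sfStep Lc j) (smStep 3 Lc j) (GcombSh (d := 3) Lc j))
    (kc := fun _ : ℕ => -((c * (Lc : ℝ) ^ (2 * (3 + 1))) * ((Lc : ℝ) ^ (3 + 1))⁻¹))
    (r := respStep (d := 3) (Lc ^ p) (Lc ^ (p + q + 1)))
    (φ := fun (μ : Fin (3 + 1)) (y v : Site (3 + 1)) =>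
      Psi (toSite (ctrOff (3 + 1) Lc)) Lc p q (fun μ' y' => if μ' = μ then (if y' = y then (1 : ℝ) else 0) else 0) v
        + PsiFace (ctrOff (3 + 1) Lc) (toSite (ctrOff (3 + 1) Lc)) Lc p q (fun μ' y' => if μ' = μ then (if y' = y then (1 : ℝ) else 0) else 0) v
        - bmGaugeAt (toSite (ctrOff (3 + 1) Lc)) (legAct (respStep (d := 3) (Lc ^ p) (Lc ^ (p + q + 1)))
            (fun μ' y' => if μ' = μ then (if y' = y then (1 : ℝ) else 0) else 0)) Lc v)
    hLc1 (decays_combStep (d := 3) (Lc := Lc)) hW hδS p q (L := Lc ^ (q + 1)) rfl hκ₀0 hgap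
    ha0 ha'0 haφ0 haρ0 hg hg hE hr hr' hφ hl₁ hWb hq₂ hq₁ hq₁₂ hD₂ hD₁
  have hpin := abs_prod_kcPin_le (d := 3) hLc1 hc p q
  refine locStencil₂_weaken R ?_ ?_
  · refine (mul_le_mul_of_nonneg_right hpin (by positivity)).trans (le_of_eq ?_)
    rw [hθq, hCgq, hP, hX]
    ring
  · have : δ = κ₀ / 3 / (6 * (((3 : ℕ) : ℝ) + 1)) := by rw [hκ₀]; field_simp; ring
    exact this.le

/-- NOT IN PRINT; OUR BOOKKEEPING.  **(III′) — THE (H1w) LETTER FOR THE COMB-CHART LEGS: ALL SHORT WINDOWS `q < k₀` AT ONE PAIR OF CONSTANTS** (as displayed in the module docstring; `q = 0` is the identity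
window, by monotonicity `δ ≤ δ_S`; for `q ≥ 1` the gap follows from `108(d+1)·δ ≤ δ_S·Lc`). -/
theorem short_windows_of_combChart (hLc : 2 ≤ Lc) {c : ℝ} (hc : |c| ≤ (Lc : ℝ) ^ (2 * (3 + 1))) :
    ∃ κ₁ : ℝ, 0 < κ₁ ∧ ∀ δS δ : ℝ, 0 < δ → δ ≤ δS → 18 * (((3 : ℕ) : ℝ) + 1) * δ ≤ κ₁ → 108 * (((3 : ℕ) : ℝ) + 1) * δ ≤ δS * (Lc : ℝ) →
      ∀ k₀ : ℕ, ∃ A B : ℝ, 1 ≤ A ∧ 0 ≤ B ∧ ∀ (p q : ℕ) (W : Tab 3) (C g : ℝ), q < k₀ →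
          (∃ B' : ℝ, ∀ κ u κ' u' x z a b, |W κ u κ' u' x z a b| ≤ B') → LocStencil₂ W C δS →
          (∀ (κ₁ : Fin (3 + 1)) (v : Site (3 + 1)) (κ₂ : Fin (3 + 1)) (x p : Site (3 + 1)) (f b : Fib 3),
              |∑' v', W κ₁ v κ₂ v' x p f b| ≤ g * Real.exp (-δS * (l1 (x - v) + l1 (p - v)))) →
          (∀ (κ₁ κ₂ : Fin (3 + 1)) (v' x p : Site (3 + 1)) (f b : Fib 3),
              |∑' v, W κ₁ v κ₂ v' x p f b| ≤ g * Real.exp (-δS * (l1 (x - v') + l1 (p - v')))) →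
          (∀ (κ₁ κ₂ : Fin (3 + 1)) (x p : Site (3 + 1)) (f b : Fib 3),
              |∑' v, ∑' v', W κ₁ v κ₂ v' x p f b| ≤ g * Real.exp (-δS * l1 (p - x))) →
          (∀ (κ : Fin (3 + 1)) (v w x p : Site (3 + 1)) (f b : Fib 3),
              |∑ μ, (W κ v μ (w - unitVec μ) x p f b - W κ v μ w x p f b)|
                ≤ g * Real.exp (-δS * l1 (w - v)) * Real.exp (-δS * (l1 (x - v) + l1 (p - v)))) →
          (∀ (κ' : Fin (3 + 1)) (w v' x p : Site (3 + 1)) (f b : Fib 3),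
              |∑ κ, (W κ (w - unitVec κ) κ' v' x p f b - W κ w κ' v' x p f b)|
                ≤ g * Real.exp (-δS * l1 (v' - w)) * Real.exp (-δS * (l1 (x - w) + l1 (p - w)))) →
          LocStencil₂
            (Lin4LegTowerUnroll.legChain (fun _ : ℕ => -((c * (Lc : ℝ) ^ (2 * (3 + 1))) * ((Lc : ℝ) ^ (3 + 1))⁻¹))
              (fun j => unitK (sfStep Lc j) (smStep 3 Lc j) (GcombSh (d := 3) Lc j)) Lc p q
              (fun κ u κ' u' => bsumPow Lc q (W κ u κ' u')))
            (A * C + B * g) δ := by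
  classical
  have hLpos : (0 : ℝ) < (Lc : ℝ) := by exact_mod_cast (lt_of_lt_of_le (by norm_num) hLc)
  have hL1 : (1 : ℝ) ≤ Lc := by exact_mod_cast (le_trans (by norm_num) hLc)
  obtain ⟨κ₁, hκ₁, hwin⟩ := comb_window_two_rates (Lc := Lc) hLc hc
  refine ⟨κ₁, hκ₁, ?_⟩
  intro δS δ hδ hδδS hδκ hgap1 k₀
  have hδS : 0 < δS := lt_of_lt_of_le hδ hδδS
  have hq := hwin δS δ hδS hδ hδκ
  choose θf Cgf hθf hCgf hW using hq
  refine ⟨1 + ∑ q ∈ Finset.range k₀, θf q, ∑ q ∈ Finset.range k₀, Cgf q,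
    le_add_of_nonneg_right (Finset.sum_nonneg fun q _ => hθf q), Finset.sum_nonneg fun q _ => hCgf q, ?_⟩
  intro p q W C g hqk hB hWS hq₂ hq₁ hq₁₂ hD₂ hD₁
  have hg : 0 ≤ g := nonneg_of_dominated (Real.exp_pos _) (hq₁₂ 0 0 0 0 (Sum.inl 0) (Sum.inl 0))
  have hC0 : 0 ≤ C := hWS.nonneg
  have hAθ : ∀ q', q' < k₀ → θf q' ≤ 1 + ∑ q ∈ Finset.range k₀, θf q := fun q' hq' =>
    (Finset.single_le_sum (f := θf) (fun q _ => hθf q) (Finset.mem_range.2 hq')).trans (le_add_of_nonneg_left zero_le_one)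
  have hBC : ∀ q', q' < k₀ → Cgf q' ≤ ∑ q ∈ Finset.range k₀, Cgf q := fun q' hq' =>
    Finset.single_le_sum (f := Cgf) (fun q _ => hCgf q) (Finset.mem_range.2 hq')
  cases q with
  | zero =>
    -- the identity window: `legChain … p 0 = id`, `bsumPow Lc 0 = id`; weaken rate `δ ≤ δ_S` and constant `C ≤ A·C + B·g`
    have e : (Lin4LegTowerUnroll.legChain (fun _ : ℕ => -((c * (Lc : ℝ) ^ (2 * (3 + 1))) * ((Lc : ℝ) ^ (3 + 1))⁻¹))
        (fun j => unitK (sfStep Lc j) (smStep 3 Lc j) (GcombSh (d := 3) Lc j)) Lc p 0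
        (fun κ u κ' u' => bsumPow Lc 0 (W κ u κ' u'))) = W := by
      funext κ u κ' u'; rfl
    rw [e]
    refine locStencil₂_weaken hWS ?_ hδδS
    have h1 : C ≤ (1 + ∑ q ∈ Finset.range k₀, θf q) * C :=
      le_mul_of_one_le_left hC0 (le_add_of_nonneg_right (Finset.sum_nonneg fun q _ => hθf q))
    nlinarith [Finset.sum_nonneg (fun q (_ : q ∈ Finset.range k₀) => hCgf q), mul_nonneg (Finset.sum_nonneg (fun q (_ : q ∈ Finset.range k₀) => hCgf q)) hg]
  | succ q =>
    have hgapq : 108 * (((3 : ℕ) : ℝ) + 1) * δ ≤ δS * (Lc : ℝ) ^ (q + 1) := by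
      refine hgap1.trans ?_
      rw [pow_succ]
      have : (Lc : ℝ) ≤ (Lc : ℝ) ^ q * Lc := le_mul_of_one_le_left hLpos.le (one_le_pow₀ hL1)
      exact mul_le_mul_of_nonneg_left this hδS.le
    have R := hW q hgapq p W C g hB hWS hq₂ hq₁ hq₁₂ hD₂ hD₁
    refine locStencil₂_weaken R ?_ le_rfl
    have h1 := mul_le_mul_of_nonneg_right (hAθ q (by omega)) hC0
    have h2 := mul_le_mul_of_nonneg_right (hBC q (by omega)) hg
    linarith

end Summit.QuantumFields.BalabanUV.Beta.GAN24.CombNaturalWindowShort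

end
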